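import Summits.ResolutionOfSingularities.ResolutionOfSingularities.Theorems.EquisingularLiftEquisingularLiftNatF102QuasiFinite
import Summits.ResolutionOfSingularities.ResolutionOfSingularities.Theorems.EquisingularLiftEquisingularLiftNatF102CodimOneRegularImmersion
import Summits.ResolutionOfSingularities.ResolutionOfSingularities.Theorems.EquisingularLiftEquisingularLiftNatF102IdealLineBundle
import Literature.AlgebraicGeometry.Resolution.AlterationsSectionDivisor
import Literature.AlgebraicGeometry.Resolution.ProjectiveSpaceRegular
import Literature.AlgebraicGeometry.Resolution.AdicCompletionRegular
import Mathlib.RingTheory.DiscreteValuationRing.TFAE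
import HarnessLib

/-!
# [OURS · L1 W4.5(b) · LINE (T-j)-PROOF · BRICK B4, sub-brick (B4-a3)] A SECTION of the F-102 curve is a regular immersion of
# codimension one, and its ideal sheaf is a line bundle

Crux chain w45b (cell `res-hironaka`), EL♮(3) stmt-ResolutionOfSingularities-20148, LINE (T-j)-PROOF of F-102
`Literature.AlgebraicGeometry.Resolution.GenusZeroOverCompleteDVR` (res-L1-w45b-lead-2 g3, skeleton v3 1683bb741349c142), BRICK B4
`F102.exists_coordinate_functions`, step (B4-a) «`𝓘_{D_j}` is an invertible ideal» (res-L1-type-o6 g30). OURS; NOT a statement of any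
manuscript; AI-written, weaker than expert review. No `sorry`; standard axioms; DEF-FREE. `--supports stmt-ResolutionOfSingularities-20148 --as helper`.

SETTING (the binders of B4): `O` a DVR with residue map `θ : O ↠ k`, `f : C → Spec O` proper and flat, `(i, t; f, Spec θ)` the cartesian
square of the closed fibre `Ck`, `Ck ≅ ℙ¹_{k'}`, `C` regular and integral (G1 `isIntegral_of_isRegular`, p575507), `s : Spec O → C` a section
(`s ≫ f = 𝟙`).

* `isRegular_Spec_of_isDiscreteValuationRing` — `Spec O` is a regular scheme.
* `ringKrullDim_quotient_stalkIdeal_ker_section` — at a point `s p` of the section, `dim (𝒪_{C,s p} ⧸ (ker s)_{s p}) = dim 𝒪_{Spec O,p}`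
  (`𝒪_{C,s p} ⧸ (ker s)_{s p} ≅ 𝒪_{Spec O,p}` through `s^♯`).
* **`isRegularImmersionOfCodim_one_of_section`** — `IsRegularImmersionOfCodim s 1`: the closed points `y` of `D = s(Spec O)` lie over the
  closed point (properness), so `dim 𝒪_{C,y} = 2` (G0, res-D-pv-035's `ringKrullDim_stalk_eq_two_of_isClosed`, p(S6)) and
  `dim 𝒪_{C,y} ⧸ 𝓘_{D,y} = dim O = 1`; the codimension-one condition spreads to all of `supp (ker s)` (res-L1-w45b-stub-3's
  `forall_codim_of_isClosed`), `V(ker s) ≅ Spec O` is regular, and (B4-a2) `isRegularImmersionOfCodim_one_of_codim_one` (p576817) applies to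
  `(ker s).subschemeι`, whence to `s = s.toImage ≫ (ker s).subschemeι` (`s.toImage` an isomorphism).
* **`isVectorBundle_idealModule_of_section`** — `Motives.IsVectorBundle (Deformation.idealModule s)` ((B4-a1)
  `isVectorBundle_idealModule_of_isRegularImmersionOfCodim_one`, p576456): the hypothesis `hF` of BRICK E for `𝓘_{D₀}`, `𝓘_{D₁}` and (with the
  tree's `Modules.isFiniteLocallyFree_sheafHom'`) for `𝓗om(𝓘_{D₀}, 𝓘_{D₁})`.

References: H. Matsumura, *Commutative Ring Theory* (1986), Thm. 14.2, Thm. 15.1 [cite: Matsumura1987]; The Stacks Project, Tags 00KW, 00NQ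
[cite: StacksProject]. Tree: the files imported above.
-/

set_option linter.dupNamespace false -- mandated namespace `Summit.<Summit>.<Problem>` of this single-conjunct summit
set_option linter.overlappingInstances false -- signature carries `[IsDomain O] [IsDiscreteValuationRing O]`

noncomputable section

open CategoryTheory AlgebraicGeometry IsLocalRing TopologicalSpace Topology
open Literature.AlgebraicGeometry.Resolution Literature.AlgebraicGeometry.HodgeTheory
open Literature.AlgebraicGeometry.Morphisms Literature.AlgebraicGeometry
open Literature.AlgebraicGeometry.Morphisms (ProjCech.PP ProjCech.toSpec)
open AlgebraicGeometry.Scheme.IdealSheafData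
open Summit.ResolutionOfSingularities.ResolutionOfSingularities.Cruxes.EquisingularLiftNat.Sections

namespace Summit.ResolutionOfSingularities.ResolutionOfSingularities.Cruxes.EquisingularLiftNat.F102

/-- `Spec` of a discrete valuation ring is a regular scheme (a DVR is a regular local ring, hence a regular ring).
[cite: Matsumura1987, Thm. 14.2, §11] -/
theorem isRegular_Spec_of_isDiscreteValuationRing (O : Type) [CommRing O] [IsDomain O] [IsDiscreteValuationRing O] :
    Scheme.IsRegular (Spec (.of O)) := by
  haveI : IsRegularRing O := isRegularRing_of_isRegularLocalRing O
  exact Scheme.isRegular_Spec (.of O)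

/-- At a point `s p` of a section `s` of `f : C → Spec O` (indeed of any closed immersion `s`), the quotient of `𝒪_{C,s p}` by the stalk of
`ker s` is `𝒪_{Spec O,p}`: `dim (𝒪_{C,s p} ⧸ (ker s)_{s p}) = dim 𝒪_{Spec O,p}`. [folklore] -/
theorem ringKrullDim_quotient_stalkIdeal_ker_section {O : Type} [CommRing O] {C : Scheme.{0}} (s : Spec (.of O) ⟶ C)
    [IsClosedImmersion s] (p : Spec (.of O)) :
    ringKrullDim (C.presheaf.stalk (s p) ⧸ stalkIdeal s.ker (s p)) = ringKrullDim ((Spec (.of O)).presheaf.stalk p) := by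
  have hker : RingHom.ker (s.stalkMap p).hom = stalkIdeal s.ker (s p) := (stalkIdeal_ker_eq_ker_stalkMap s p).symm
  exact ringKrullDim_eq_of_ringEquiv
    ((Ideal.quotEquivOfEq hker.symm).trans (RingHom.quotientKerEquivOfSurjective (s.stalkMap_surjective p)))

/-- The local ring of `Spec O` at the closed point of a DVR `O` is `1`-dimensional. [cite: Matsumura1987, Thm. 11.2] -/
theorem ringKrullDim_stalk_closedPoint_eq_one (O : Type) [CommRing O] [IsDomain O] [IsDiscreteValuationRing O] :
    ringKrullDim ((Spec (.of O)).presheaf.stalk (closedPoint O)) = ((1 : ℕ) : WithBot ℕ∞) := by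
  set R := (Spec (.of O)).presheaf.stalk (closedPoint O) with hR
  letI : Algebra O R := StructureSheaf.stalkAlgebra O (closedPoint O)
  haveI : IsLocalization.AtPrime R (closedPoint O).asIdeal := StructureSheaf.IsLocalization.to_stalk O (closedPoint O)
  rw [IsLocalization.AtPrime.ringKrullDim_eq_height (closedPoint O).asIdeal R]
  change ((maximalIdeal O).height : WithBot ℕ∞) = _
  rw [IsLocalRing.maximalIdeal_height_eq_ringKrullDim, IsDiscreteValuationRing.ringKrullDim_eq_one]
  rfl

/-- **(B4-a3) A section of the F-102 curve is a regular immersion of codimension one.** `f : C → Spec O` proper and flat over a DVR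
with residue map `θ : O ↠ k`, closed fibre `Ck ≅ ℙ¹_{k'}` (cartesian square `(i, t; f, Spec θ)`), `C` regular and integral, `s` a section
of `f`: the ideal of `D = s(Spec O)` is generated near every point by one nonzerodivisor. [cite: Matsumura1987, Thm. 14.2, Thm. 15.1]
[cite: StacksProject, Tag 00KW] [OURS · L1 W4.5b · brick B4 (a3)] toward `F102.exists_coordinate_functions`; NOT a statement of the manuscript. -/
theorem isRegularImmersionOfCodim_one_of_section (O : Type) [CommRing O] [IsDomain O] [IsDiscreteValuationRing O]
    (k : Type) [Field k] (θ : O →+* k) (C : Scheme.{0}) (f : C ⟶ Spec (.of O)) [IsProper f] [Flat f]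
    (Ck : Scheme.{0}) (i : Ck ⟶ C) (t : Ck ⟶ Spec (.of k)) (hθ : Function.Surjective θ)
    (hreg : Scheme.IsRegular C) [IsIntegral C] (hsq : IsPullback i t f (Spec.map (CommRingCat.ofHom θ)))
    (hP1 : ∃ (k' : Type) (_ : Field k'), Nonempty (Ck ≅ ProjCech.PP k' 1))
    (s : Spec (.of O) ⟶ C) (hs : s ≫ f = 𝟙 _) : IsRegularImmersionOfCodim s 1 := by
  haveI : IsLocallyNoetherian C := LocallyOfFiniteType.isLocallyNoetherian f
  haveI : IsClosedImmersion (s ≫ f) := by rw [hs]; infer_instance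
  haveI : IsClosedImmersion s := IsClosedImmersion.of_comp s f
  haveI : CompactSpace C := (compactSpace_and_apply_eq_closedPoint_of_isProper O f).1
  -- `V(ker s) ≅ Spec O` is regular
  have h𝒞reg : Scheme.IsRegular s.ker.subscheme :=
    Scheme.IsRegular.of_isOpenImmersion (inv s.toImage) (isRegular_Spec_of_isDiscreteValuationRing O)
  -- the support of `ker s` is the (closed) image of `s`
  have hsupp : (s.ker.support : Set C) = Set.range s := by
    rw [Scheme.Hom.support_ker, s.isClosedEmbedding.isClosed_range.closure_eq]
  -- `hcodim` at the closed points of the support, hence everywhere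
  have hcod : ∀ y ∈ s.ker.support, IsClosed ({y} : Set C) →
      ringKrullDim (C.presheaf.stalk y ⧸ stalkIdeal s.ker y) + 1 = ringKrullDim (C.presheaf.stalk y) := by
    intro y hy hycl
    rw [ringKrullDim_stalk_eq_two_of_isClosed O k θ C f Ck i t hθ hsq hP1 y hycl]
    have hyr : y ∈ Set.range s := by
      have : y ∈ (s.ker.support : Set C) := hy
      rwa [hsupp] at this
    obtain ⟨p, rfl⟩ := hyr
    have hp : p = closedPoint O := by
      have h := apply_eq_closedPoint_of_isClosed_singleton f (s p) hycl
      rwa [← Scheme.Hom.comp_apply, hs] at h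
    subst hp
    rw [ringKrullDim_quotient_stalkIdeal_ker_section s, ringKrullDim_stalk_closedPoint_eq_one O]
    rfl
  have hcodim := forall_codim_of_isClosed hreg s.ker h𝒞reg hcod
  -- (B4-a2) for `(ker s).subschemeι`, transported to `s = s.toImage ≫ (ker s).subschemeι`
  obtain ⟨-, hι⟩ := isRegularImmersionOfCodim_one_of_codim_one s.ker hreg h𝒞reg hcodim
  refine ⟨inferInstance, fun z => ?_⟩
  obtain ⟨U, hzU, rs, hlen, hwreg, hI⟩ := hι (s.toImage z)
  refine ⟨U, ?_, rs, hlen, hwreg, ?_⟩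
  · have h : s.ker.subschemeι (s.toImage z) = s z := by
      rw [← Scheme.Hom.comp_apply, Scheme.Hom.toImage_imageι]
    exact h ▸ hzU
  · rw [hI, Scheme.IdealSheafData.ker_subschemeι]

/-- **(B4-a3′) The ideal sheaf of a section of the F-102 curve is a line bundle**: `Motives.IsVectorBundle (Deformation.idealModule s)` — the
hypothesis `hF` of BRICK E (`P1VB.exists_unitSection_eq_of_ker_le_span`, p574087) for `𝓘_{D_j}`. [cite: Matsumura1987, Thm. 14.2]
[OURS · L1 W4.5b · brick B4 (a3)] toward `F102.exists_coordinate_functions`; NOT a statement of the manuscript. -/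
theorem isVectorBundle_idealModule_of_section (O : Type) [CommRing O] [IsDomain O] [IsDiscreteValuationRing O]
    (k : Type) [Field k] (θ : O →+* k) (C : Scheme.{0}) (f : C ⟶ Spec (.of O)) [IsProper f] [Flat f]
    (Ck : Scheme.{0}) (i : Ck ⟶ C) (t : Ck ⟶ Spec (.of k)) (hθ : Function.Surjective θ)
    (hreg : Scheme.IsRegular C) [IsIntegral C] (hsq : IsPullback i t f (Spec.map (CommRingCat.ofHom θ)))
    (hP1 : ∃ (k' : Type) (_ : Field k'), Nonempty (Ck ≅ ProjCech.PP k' 1))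
    (s : Spec (.of O) ⟶ C) (hs : s ≫ f = 𝟙 _) : Motives.IsVectorBundle (Deformation.idealModule s) := by
  haveI : IsLocallyNoetherian C := LocallyOfFiniteType.isLocallyNoetherian f
  exact isVectorBundle_idealModule_of_isRegularImmersionOfCodim_one s
    (isRegularImmersionOfCodim_one_of_section O k θ C f Ck i t hθ hreg hsq hP1 s hs)

end Summit.ResolutionOfSingularities.ResolutionOfSingularities.Cruxes.EquisingularLiftNat.F102

end
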